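import Summits.HodgeConjecture.HodgeConjecture.Theorems.NikulinTwinTransportHodgeIsometryAlgebraic
import Literature.AlgebraicGeometry.Surfaces.K3SurfaceBuskinLeaves
import Summits.HodgeConjecture.HodgeConjecture.Theorems.EndoscopicMiddleDegreeCupProductAlgebraicOfChernCharacter
import Literature.AlgebraicGeometry.HodgeTheory.ComplexConjugationHolds
import HarnessLib

/-!
# Route NikulinTwinTransport · `HodgeIsometryAlgebraic` (stmt-HodgeConjecture-13675): the cup-product leaf replaced by the K-theoretic named facts

Of the four named leaves of Buskin's Theorem 1.1 (`Surfaces/K3SurfaceBuskinLeaves`;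
closing form `hodgeIsometryAlgebraic_of_leaves`), the second —
`cupProduct_mem_algebraicClasses_tripleProduct_surfaces`, `N²H⁴ ∪ N²H⁴ ⊆ N⁴H⁸` on triple products
`A ⊗ (B ⊗ C)` of smooth projective surfaces (Voisin II Prop. 9.20; the instance consumed by the
composition of correspondences, Buskin Lemma 6.3) — has in the tree only the moving-lemma
reduction (`HodgeTheory/AlgebraicClassesCup`). The sibling route's theorem
`EndoscopicMiddleDegree.cupProductAlgebraic_of_span_chernCharacter`
(`Theorems/EndoscopicMiddleDegreeCupProductAlgebraicOfChernCharacter`) proves the GENERAL statement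
`CupProductAlgebraic` from two pre-existing named facts of the tree:

* `HodgeTheory.span_holomorphicBundleChernCharacter_eq_algebraicClasses` — Voisin I Thm. 11.32 ⊗ ℂ
  (on a smooth projective `X`, the `ℂ`-span of the Chern characters of holomorphic bundles is
  `algebraicClasses X p`), and
* `HodgeTheory.nonempty_hodgeModel` — smooth projective complex varieties have Hodge models
  (Serre GAGA §2, de Rham, the Hodge decomposition).

This file specialises it to the leaf (`cupProduct_tripleProduct_surfaces_of_cupProductAlgebraic`,
`…_of_span_chernCharacter`) and records the item's closing form CONDITIONAL on the resulting
five named facts — Prop. 6.2 (reflective case), Thm. 11.32 ⊗ ℂ, Hodge models, period surjectivity,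
markings — none of which is specific to cup products (`hodgeIsometryAlgebraic_of_leaves_of_span_chernCharacter`).
The item is not closed by this file (the gate's `conditional-result`).
Prover seat prover-HodgeConjecture-route-HodgeConjecture-NikulinTwinTransport-0.
-/

namespace Summit.HodgeConjecture.HodgeConjecture.Theorems.NikulinTwinTransport

open CategoryTheory MonoidalCategory
open Literature.AlgebraicGeometry Literature.AlgebraicGeometry.HodgeTheory
open Literature.AlgebraicGeometry.Surfaces
open Summit.HodgeConjecture.HodgeConjecture.Theses.EndoscopicMiddleDegree (CupProductAlgebraic)

/-- **The cup-product leaf is the `(2,2)` instance of `CupProductAlgebraic` on triple products of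
surfaces**: `A ⊗ (B ⊗ C)` is smooth projective of dimension `2 + (2 + 2)`
(`IsSmoothProjective.tensor_holds`), and `N²H⁴ ∪ N²H⁴ ⊆ N⁴H⁸` there is `CupProductAlgebraic` at
`l = k = 2`. [cite: VoisinHodgeII2003, §9.2.4 Prop. 9.20] -/
theorem cupProduct_tripleProduct_surfaces_of_cupProductAlgebraic (hC : CupProductAlgebraic) :
    cupProduct_mem_algebraicClasses_tripleProduct_surfaces :=
  fun _ _ _ hA hB hC' a ha b hb ↦
    hC (Motives.IsSmoothProjective.tensor_holds hA (Motives.IsSmoothProjective.tensor_holds hB hC'))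
      2 2 a b ha hb

/-- **The cup-product leaf from Voisin I Thm. 11.32 ⊗ ℂ and the existence of Hodge models**:
`cupProduct_mem_algebraicClasses_tripleProduct_surfaces` follows from
`span_holomorphicBundleChernCharacter_eq_algebraicClasses` and `nonempty_hodgeModel` (for all
smooth projective varieties) through the sibling route's
`EndoscopicMiddleDegree.cupProductAlgebraic_of_span_chernCharacter` (`a ∪ b = Δ^*(a ⊠ b)`,
algebraicity of exterior products, naturality of Chern characters under `Δ^*`).
[cite: VoisinHodgeI2002, Thm. 11.32] [cite: VoisinHodgeII2003, §9.2.4 Prop. 9.20 and Prop. 9.21 (i)] -/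
theorem cupProduct_tripleProduct_surfaces_of_span_chernCharacter
    (h₁ : span_holomorphicBundleChernCharacter_eq_algebraicClasses)
    (hA : ∀ (n : ℕ) (X : Motives.SchemeOver ℂ), nonempty_hodgeModel n X) :
    cupProduct_mem_algebraicClasses_tripleProduct_surfaces :=
  cupProduct_tripleProduct_surfaces_of_cupProductAlgebraic
    (EndoscopicMiddleDegree.cupProductAlgebraic_of_span_chernCharacter h₁ hA)

/-- **`HodgeIsometryAlgebraic` from Prop. 6.2 (reflective case), Voisin I Thm. 11.32 ⊗ ℂ, the
existence of Hodge models, the surjectivity of the period map and the existence of markings** —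
the assembly `Buskin2019_hodgeIsometry_algebraic_holds_of` of the four leaves (as in
`hodgeIsometryAlgebraic_of_leaves`, file `…HodgeIsometryAlgebraicLeaves`) with its cup-product leaf
discharged from the two K-theoretic/analytic named facts
(`cupProduct_tripleProduct_surfaces_of_span_chernCharacter`), through the by-name bridge
`hodgeIsometryAlgebraic_of_buskin`.
CONDITIONAL on the five named facts (hypotheses); unconditional in everything else.
[cite: Buskin2019, Thm. 1.1 and §6.2 (Prop. 6.2, Lemma 6.3)] [cite: VoisinHodgeI2002, Thm. 11.32]
[cite: VoisinHodgeII2003, §9.2.4 Prop. 9.20] -/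
theorem hodgeIsometryAlgebraic_of_leaves_of_span_chernCharacter
    (hrefl : Buskin2019_reflectiveHodgeIsometry_algebraic)
    (h₁ : span_holomorphicBundleChernCharacter_eq_algebraicClasses)
    (hA : ∀ (n : ℕ) (X : Motives.SchemeOver ℂ), nonempty_hodgeModel n X)
    (h : Huybrechts_K3_periodSurjective_projective) (hM : Huybrechts_K3_marking_exists) :
    Summit.HodgeConjecture.HodgeConjecture.Theses.NikulinTwinTransport.HodgeIsometryAlgebraic :=
  hodgeIsometryAlgebraic_of_buskin
    (Buskin2019_hodgeIsometry_algebraic_holds_of hrefl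
      (cupProduct_tripleProduct_surfaces_of_span_chernCharacter h₁ hA) h hM)

/-!
## The Hodge-model hypothesis discharged (2026-08-16)

`HodgeTheory.nonempty_hodgeModel` is now a THEOREM of the Literature library
(`HodgeTheory.nonempty_hodgeModel_holds`, file `HodgeTheory/ComplexConjugationHolds`: Serre's
analytification, de Rham's theorem, the Hodge decomposition of compact Kähler manifolds — all
proved upstream). The two closing forms above are therefore re-recorded without the hypothesis
`hA`: the cup-product leaf rests on Voisin I Thm. 11.32 ⊗ ℂ alone, and the item's closing form on
FOUR pre-existing named facts (Prop. 6.2 reflective case, Thm. 11.32 ⊗ ℂ, period surjectivity,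
markings).
-/

/-- **`CupProductAlgebraic` (the sibling route's general statement `NˡH²ˡ ∪ NᵏH²ᵏ ⊆ N^{l+k}H^{2(l+k)}`
on every smooth projective `X/ℂ`) from Voisin I Thm. 11.32 ⊗ ℂ alone** — the sibling route's
`EndoscopicMiddleDegree.cupProductAlgebraic_of_span_chernCharacter` with its Hodge-model hypothesis
discharged by the theorem `nonempty_hodgeModel_holds`. Recorded here because the composition of
correspondences of this route (Buskin Lemma 6.3) consumes exactly its `(2,2)` instance on triple
products. [cite: VoisinHodgeI2002, Thm. 11.32] [cite: VoisinHodgeII2003, §9.2.4 Prop. 9.20] -/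
theorem cupProductAlgebraic_of_span_chernCharacter_eq
    (h₁ : span_holomorphicBundleChernCharacter_eq_algebraicClasses) : CupProductAlgebraic :=
  EndoscopicMiddleDegree.cupProductAlgebraic_of_span_chernCharacter h₁ fun _ _ ↦ nonempty_hodgeModel_holds

/-- **The cup-product leaf from Voisin I Thm. 11.32 ⊗ ℂ alone**:
`cupProduct_mem_algebraicClasses_tripleProduct_surfaces` (`N²H⁴ ∪ N²H⁴ ⊆ N⁴H⁸` on triple products
of smooth projective surfaces) follows from `span_holomorphicBundleChernCharacter_eq_algebraicClasses`,
the existence of Hodge models being the theorem `nonempty_hodgeModel_holds`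
(the `(2,2)` instance of `cupProductAlgebraic_of_span_chernCharacter_eq`).
[cite: VoisinHodgeI2002, Thm. 11.32] [cite: VoisinHodgeII2003, §9.2.4 Prop. 9.20 and Prop. 9.21 (i)] -/
theorem cupProduct_tripleProduct_surfaces_of_span_chernCharacter_eq
    (h₁ : span_holomorphicBundleChernCharacter_eq_algebraicClasses) :
    cupProduct_mem_algebraicClasses_tripleProduct_surfaces :=
  cupProduct_tripleProduct_surfaces_of_cupProductAlgebraic (cupProductAlgebraic_of_span_chernCharacter_eq h₁)

/-- **`HodgeIsometryAlgebraic` from FOUR pre-existing named facts** — Prop. 6.2 (reflective case),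
Voisin I Thm. 11.32 ⊗ ℂ, the surjectivity of the period map and the existence of markings: the
assembly `Buskin2019_hodgeIsometry_algebraic_holds_of` of the four leaves of Buskin's Theorem 1.1
with its cup-product leaf discharged from Thm. 11.32 ⊗ ℂ
(`cupProduct_tripleProduct_surfaces_of_span_chernCharacter_eq`, Hodge models being the theorem
`nonempty_hodgeModel_holds`), through the by-name bridge `hodgeIsometryAlgebraic_of_buskin`.
CONDITIONAL on the four named facts (hypotheses); unconditional in everything else. The item closes
(`hodgeIsometryAlgebraic_of_buskin Buskin2019_hodgeIsometry_algebraic_holds`) the day their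
`_holds` land.
[cite: Buskin2019, Thm. 1.1 and §6.2 (Prop. 6.2, Lemma 6.3)] [cite: VoisinHodgeI2002, Thm. 11.32]
[cite: Huybrechts2016K3, Ch. 6–7 (surjectivity of the period map) and Ch. 1 Prop. 3.5 (markings)] -/
theorem hodgeIsometryAlgebraic_of_reflective_of_span_chernCharacter_eq
    (hrefl : Buskin2019_reflectiveHodgeIsometry_algebraic)
    (h₁ : span_holomorphicBundleChernCharacter_eq_algebraicClasses)
    (h : Huybrechts_K3_periodSurjective_projective) (hM : Huybrechts_K3_marking_exists) :
    Summit.HodgeConjecture.HodgeConjecture.Theses.NikulinTwinTransport.HodgeIsometryAlgebraic :=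
  hodgeIsometryAlgebraic_of_buskin
    (Buskin2019_hodgeIsometry_algebraic_holds_of hrefl
      (cupProduct_tripleProduct_surfaces_of_span_chernCharacter_eq h₁) h hM)

end Summit.HodgeConjecture.HodgeConjecture.Theorems.NikulinTwinTransport
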